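import Mathlib
import Summits.Ventures.FusionMHD.Models.SolovevPCF
import Literature.MathematicalPhysics.MHD.SolovevNearAxis
import Literature.MathematicalPhysics.MHD.MercierNearAxis
import HarnessLib

/-!
# Ventures/FusionMHD — Models/SolovevPCFMercierAxis.lean: the near-axis Mercier / Lortz criteria
# (Bateman 1978 (7.3.2), typed by lit-3) evaluated on the F1.a analytic equilibria of record (F-parametric)

HONEST FRAMING (LADDER-GRIDFUSION three columns; rung F1.MER-axis).
* CERTIFIED (kernel, this file): exact rational identities and inequalities — the near-axis parameter map
  of the PCF Solov'ev instances of record (`e² = Ψ_RR/Ψ_ZZ` exact rational, shift `S = −1/2`, `d = 0`,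
  jet-triangularity `= 1/(2e)`), and, for the typed criterion `Mercier.NearAxis.MercierCriterion q e Q d`
  (`1/q² < bound e Q d 1`, Bateman (7.3.2) with `δ = 1`) with `q = q₀(F)` the typed on-axis safety factor
  (Freidberg (6.42), `GradShafranov.safetyFactorOnAxis`, `q₀² = F²·r` exact), `e = κ₀` the typed on-axis
  elongation (`GradShafranov.elongationOnAxis`), `Q = 0`, `d = 0`: **ITER-like: the criterion HOLDS for every
  `F ≥ 0.6191` and FAILS for every `0 < F ≤ 0.619`; NSTX-like: holds for `F ≥ 1.1186`, fails for
  `0 < F ≤ 1.1185`** (so the model thresholds `F_M = 0.61902…`, `1.11855…`, i.e. `q₀ > 1.2327` resp.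
  `q₀ > 1.3770`, are certified to four decimals); and the Lortz (`δ = 0`, sufficient) companion, whose bound is
  RATIONAL in `E = e²`: ITER-like holds for `F ≥ 1.2363`, fails for `0 < F ≤ 1.2362`; NSTX-like `1.814` /
  `1.8139`.
* MODELLED (not certified here, carried verbatim from the typed sources): (a) (7.3.2) IS the near-axis form of
  Mercier's necessary criterion / Lortz's sufficient criterion (Lortz–Nührenberg 1973, Lortz 1973 via
  Bateman1978 §7.3 — `Literature/MathematicalPhysics/MHD/MercierNearAxis.lean`, whose TRANSCRIPTION STATUS
  block applies: single OCR secondary, three proved consistency checks, primaries acq-11723/11790/11791);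
  (b) the DICTIONARY from the flux function's axis jets to Bateman's `(e, S, Δ, d)`: matching the cubic Taylor
  jet of `Ψ` at the axis with the volume expansion (7.3.3) (area of `{G ≤ g}` to leading order, lengths in
  units of `R_a`) gives `e² = Ψ_RR/Ψ_ZZ`, `S = −R_aΨ_RRR/(6Ψ_RR)`, `Δ = R_aΨ_RZZ/(2eΨ_ZZ) + S/e` — the
  cell's derivation (pub/gridfusion/models/MODEL-5-NOTES.md §6), typed below as DEFINITIONS
  (`nearAxisShift`, `nearAxisD`, `nearAxisTriangularity`); its non-trivial self-check — (7.3.5) at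
  `Q = d = 0` demands `Δ = 1/(2e)`, and the jet value IS `1/(2e)` for every shape-fitted PCF instance — is
  PROVED (`nearAxisTriangularity_psiPCF`); (c) `Q = J^θB^ζ/(J^ζB^θ) = 0` because the PCF profile has
  `FF′ = 0` (no poloidal current: `J_pol ∝ F′(Ψ)∇Ψ × e_φ = 0`); (d) Bateman's `q` (7.1.8)
  `= dψ_tor/dψ_pol` equals Freidberg's `q₀` (6.42) on the axis; (e) the equilibria are the ANALYTIC PCF
  Solov'ev instances (ideal MHD, `μ₀p′ = −1`, `FF′ = 0`, fixed boundary; `Models/SolovevPCF.lean`) — the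
  words «ITER-like»/«NSTX-like» name printed shape triples only. Mercier's criterion is NECESSARY for
  ideal-interchange stability of the MODEL near its axis; nothing here says any configuration is stable.
* VALIDATED (not used): the cell's float evaluation (MODEL-5-NOTES §6: ITER-like `q₀ > 1.23269 ⇔ F > 0.61903`,
  NSTX-like `q₀ > 1.37697 ⇔ F > 1.11855`; Lortz `2.46173`/`2.23304`) agrees with the certified brackets.

Inputs: `Models/SolovevPCF.lean` (instances, `hessian_axis`, `q0_sq`), `Literature/…/SolovevNearAxis.lean`
(third-order jets, `psiPCF_nearAxisRatios`), `Literature/…/MercierNearAxis.lean` (lit-3: `bound`,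
`MercierCriterion`, `LortzCriterion`, `shift`, `triangularity`, certification lemmas
`mercierCriterion_of_sqrt_le` / `not_mercierCriterion_of_le_sqrt` / `lortzBound_of_sq`).
Typer/prover: gridfusion-model-5 (g2), 2026-08-26. Data: pub/gridfusion/models/solovev-pcf2013-axis-jets.json.
-/

noncomputable section

namespace Summit.Ventures.FusionMHD.Models.SolovevPCF

open Literature.MathematicalPhysics.MHD Literature.MathematicalPhysics.MHD.GradShafranov
  Literature.MathematicalPhysics.MHD.FluxGeometry Literature.MathematicalPhysics.MHD.Solovev
  Literature.MathematicalPhysics.MHD.Mercier.NearAxis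

/-! ## §1 The near-axis parameter map (MODELLED dictionary, typed as definitions) -/

/-- Near-axis SHIFT parameter read off the cubic axis jet of an up–down symmetric flux function with
magnetic axis `(R_a, 0)`: `S := −R_a Ψ_RRR(R_a,0) / (6 Ψ_RR(R_a,0))` (MODELLED dictionary to Bateman 1978
(7.3.3), lengths in units of `R_a`; cell derivation MODEL-5-NOTES §6). -/
def nearAxisShift (ψ : ℝ → ℝ → ℝ) (Ra : ℝ) : ℝ := -(Ra * dRRR ψ Ra 0) / (6 * dRR ψ Ra 0)

/-- Bateman's shift/triangularity parameter `d` from the jet shift via (7.3.4) `S = d/6 − 1/2`, i.e.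
`d := 6S + 3` (MODELLED dictionary). -/
def nearAxisD (ψ : ℝ → ℝ → ℝ) (Ra : ℝ) : ℝ := 6 * nearAxisShift ψ Ra + 3

/-- Near-axis TRIANGULARITY parameter read off the cubic axis jet: `Δ := R_a Ψ_RZZ/(2 e Ψ_ZZ) + S/e` at
`(R_a, 0)`, `e` the on-axis elongation (MODELLED dictionary to Bateman 1978 (7.3.3)). -/
def nearAxisTriangularity (ψ : ℝ → ℝ → ℝ) (Ra e : ℝ) : ℝ :=
  Ra * dRZZ ψ Ra 0 / (2 * e * dZZ ψ Ra 0) + nearAxisShift ψ Ra / e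

/-- The map is consistent with (7.3.4): Bateman's `shift` of `d := 6S + 3` is `S`. -/
theorem shift_nearAxisD (ψ : ℝ → ℝ → ℝ) (Ra : ℝ) : shift (nearAxisD ψ Ra) = nearAxisShift ψ Ra := by
  unfold nearAxisD shift; ring

/-- **Shape-fitted PCF equilibria have near-axis shift `S = −1/2`** (any `ε ≠ 0`, any `κ, δ`; needs
`Ψ_RR(R_a,0) ≠ 0`): from the exact jet ratio `R_aΨ_RRR = 3Ψ_RR` (`Solovev.psiPCF_nearAxisRatios`). -/
theorem nearAxisShift_psiPCF {ε d₁ d₂ d₃ Ra : ℝ} (hε : ε ≠ 0) (h₁ : psiPCF d₁ d₂ d₃ (1 + ε) 0 = 0)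
    (h₂ : psiPCF d₁ d₂ d₃ (1 - ε) 0 = 0) (hRa : Ra ^ 2 = 1 + ε ^ 2)
    (hRR : dRR (psiPCF d₁ d₂ d₃) Ra 0 ≠ 0) :
    nearAxisShift (psiPCF d₁ d₂ d₃) Ra = -(1 / 2) := by
  obtain ⟨h3, -⟩ := psiPCF_nearAxisRatios hε h₁ h₂ hRa
  unfold nearAxisShift
  rw [h3]
  field_simp
  ring

/-- **… hence Bateman's `d = 0`** for every shape-fitted PCF instance. -/
theorem nearAxisD_psiPCF {ε d₁ d₂ d₃ Ra : ℝ} (hε : ε ≠ 0) (h₁ : psiPCF d₁ d₂ d₃ (1 + ε) 0 = 0)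
    (h₂ : psiPCF d₁ d₂ d₃ (1 - ε) 0 = 0) (hRa : Ra ^ 2 = 1 + ε ^ 2)
    (hRR : dRR (psiPCF d₁ d₂ d₃) Ra 0 ≠ 0) :
    nearAxisD (psiPCF d₁ d₂ d₃) Ra = 0 := by
  unfold nearAxisD
  rw [nearAxisShift_psiPCF hε h₁ h₂ hRa hRR]
  ring

/-- **CONSISTENCY CHECK (iii) of the dictionary, as a theorem:** for every shape-fitted PCF instance the
jet-triangularity equals Bateman's equilibrium relation (7.3.5) at `Q = 0`, `d = 0`, namely `1/(2e)`
(`e ≠ 0`, `Ψ_RR, Ψ_ZZ ≠ 0` at the axis). -/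
theorem nearAxisTriangularity_psiPCF {ε d₁ d₂ d₃ Ra e : ℝ} (hε : ε ≠ 0)
    (h₁ : psiPCF d₁ d₂ d₃ (1 + ε) 0 = 0) (h₂ : psiPCF d₁ d₂ d₃ (1 - ε) 0 = 0) (hRa : Ra ^ 2 = 1 + ε ^ 2)
    (hRR : dRR (psiPCF d₁ d₂ d₃) Ra 0 ≠ 0) (hZZ : dZZ (psiPCF d₁ d₂ d₃) Ra 0 ≠ 0) (he : e ≠ 0) :
    nearAxisTriangularity (psiPCF d₁ d₂ d₃) Ra e = triangularity e 0 0 := by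
  obtain ⟨-, h4⟩ := psiPCF_nearAxisRatios hε h₁ h₂ hRa
  rw [triangularity_zero_zero]
  unfold nearAxisTriangularity
  rw [nearAxisShift_psiPCF hε h₁ h₂ hRa hRR, mul_assoc, mul_comm e, ← mul_assoc, ← div_div, h4]
  field_simp
  ring

/-! ## §2 ITER-like instance `(ε, κ, δ) = (8/25, 17/10, 33/100)` -/

namespace IterLike

/-- `E = κ₀² = Ψ_RR/Ψ_ZZ` on axis `= 2257675225 / 758468676` (`= −(1+8d₃)/(8d₃)`, exact; `κ₀ ≈ 1.7253`). -/
def elongSq : ℝ := 2257675225 / 758468676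

/-- The typed on-axis elongation (Freidberg (6.42) `κ₀ = (Ψ_RR/Ψ_ZZ)^{1/2}`) of the instance is `√E`. -/
theorem elongationOnAxis_eq :
    elongationOnAxis (dRR psi Ra 0) (dZZ psi Ra 0) = Real.sqrt elongSq := by
  obtain ⟨h1, h2⟩ := hessian_axis
  unfold elongationOnAxis elongSq
  rw [h1, h2]
  norm_num

/-- `κ₀² = E`. -/
theorem elongationOnAxis_sq : elongationOnAxis (dRR psi Ra 0) (dZZ psi Ra 0) ^ 2 = elongSq := by
  rw [elongationOnAxis_eq, Real.sq_sqrt (by unfold elongSq; norm_num)]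

/-- `κ₀ > 0`. -/
theorem elongationOnAxis_pos : 0 < elongationOnAxis (dRR psi Ra 0) (dZZ psi Ra 0) := by
  rw [elongationOnAxis_eq]
  exact Real.sqrt_pos.2 (by unfold elongSq; norm_num)

/-- Rational bracket `431322305063 / 250000000000 ≤ κ₀ ≤ 1725289220253 / 1000000000000` (twelve decimals). -/
theorem elongationOnAxis_bounds :
    (431322305063 / 250000000000 : ℝ) ≤ elongationOnAxis (dRR psi Ra 0) (dZZ psi Ra 0) ∧
      elongationOnAxis (dRR psi Ra 0) (dZZ psi Ra 0) ≤ 1725289220253 / 1000000000000 := by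
  rw [elongationOnAxis_eq]
  constructor
  · exact Real.le_sqrt_of_sq_le (by unfold elongSq; norm_num)
  · rw [Real.sqrt_le_left (by norm_num)]
    unfold elongSq; norm_num

/-- `Ψ_RR(R_a, 0) ≠ 0` for the instance. -/
theorem dRR_axis_ne_zero : dRR (psiPCF d₁ d₂ d₃) Ra 0 ≠ 0 := by
  rw [show psiPCF d₁ d₂ d₃ = psi from rfl, hessian_axis.1]; norm_num

/-- `Ψ_ZZ(R_a, 0) ≠ 0` for the instance. -/
theorem dZZ_axis_ne_zero : dZZ (psiPCF d₁ d₂ d₃) Ra 0 ≠ 0 := by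
  rw [show psiPCF d₁ d₂ d₃ = psi from rfl, hessian_axis.2]; norm_num

/-- Near-axis shift `S = −1/2` (ITER-like instance). -/
theorem nearAxisShift_eq : nearAxisShift psi Ra = -(1 / 2) :=
  nearAxisShift_psiPCF (ε := ε) (by unfold ε; norm_num) shapeFit.1 shapeFit.2.1
    (by rw [Ra_sq]; unfold ε; norm_num) dRR_axis_ne_zero

/-- Bateman's `d = 0` (ITER-like instance). -/
theorem nearAxisD_eq : nearAxisD psi Ra = 0 :=
  nearAxisD_psiPCF (ε := ε) (by unfold ε; norm_num) shapeFit.1 shapeFit.2.1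
    (by rw [Ra_sq]; unfold ε; norm_num) dRR_axis_ne_zero

/-- The jet-triangularity of the instance equals (7.3.5) at `Q = d = 0` (dictionary self-check). -/
theorem nearAxisTriangularity_eq :
    nearAxisTriangularity psi Ra (elongationOnAxis (dRR psi Ra 0) (dZZ psi Ra 0))
      = triangularity (elongationOnAxis (dRR psi Ra 0) (dZZ psi Ra 0)) 0 0 :=
  nearAxisTriangularity_psiPCF (ε := ε) (by unfold ε; norm_num) shapeFit.1 shapeFit.2.1
    (by rw [Ra_sq]; unfold ε; norm_num) dRR_axis_ne_zero dZZ_axis_ne_zero elongationOnAxis_pos.ne'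

/-- `1/q₀(F)² = 1/(F²·r)` is antitone in `F > 0`: the two one-sided comparisons used below. -/
theorem inv_q0_sq_le {F G : ℝ} (hG : 0 < G) (hGF : G ≤ F) :
    1 / (F ^ 2 * q0SqOverFSq) ≤ 1 / (G ^ 2 * q0SqOverFSq) := by
  have hr : (0 : ℝ) < q0SqOverFSq := by unfold q0SqOverFSq; norm_num
  apply one_div_le_one_div_of_le (by positivity)
  exact mul_le_mul_of_nonneg_right (pow_le_pow_left₀ hG.le hGF 2) hr.le

/-- `F_M⁺ = 6191 / 10000`: the model's near-axis Mercier threshold `F_M = 0.61902…` rounded UP (4 decimals). -/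
def FmercierAxis : ℝ := 6191 / 10000

/-- **The near-axis Mercier (necessary, `δ = 1`) criterion HOLDS on the ITER-like analytic equilibrium for
every `F ≥ 0.6191`** (`Q = 0`, `d = 0`; i.e. `q₀(F) ≥ 1.2328 > q₀* = 1.23269…`). CERTIFIED by lit-3's rational test
`mercierCriterion_of_sqrt_le` with `s = 431322305063 / 250000000000 ≤ κ₀`. -/
theorem mercierNearAxis_of_le {F : ℝ} (hF : FmercierAxis ≤ F) :
    MercierCriterion (safetyFactorOnAxis F Ra (dRR psi Ra 0) (dZZ psi Ra 0))
      (elongationOnAxis (dRR psi Ra 0) (dZZ psi Ra 0)) 0 (nearAxisD psi Ra) := by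
  rw [nearAxisD_eq]
  have hM : (0 : ℝ) < FmercierAxis := by unfold FmercierAxis; norm_num
  refine mercierCriterion_of_sqrt_le (E := elongSq) (s := 431322305063 / 250000000000) elongationOnAxis_sq
    (by norm_num) elongationOnAxis_bounds.1 (by norm_num) ?_
  rw [q0_sq]
  calc 1 / (F ^ 2 * q0SqOverFSq) ≤ 1 / (FmercierAxis ^ 2 * q0SqOverFSq) := inv_q0_sq_le hM hF
    _ < _ := by unfold FmercierAxis elongSq q0SqOverFSq; norm_num

/-- **… and FAILS for every `0 < F ≤ 0.619`** — so the MODEL's near-axis Mercier threshold in `F` is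
certified to lie in `(0.619, 0.6191]` (in `q₀`: `q₀* ∈ (1.2326, 1.2328]`). CERTIFIED by
`not_mercierCriterion_of_le_sqrt` with `s = 1725289220253 / 1000000000000 ≥ κ₀`. -/
theorem not_mercierNearAxis_of_le {F : ℝ} (hF0 : 0 < F) (hF : F ≤ 619 / 1000) :
    ¬ MercierCriterion (safetyFactorOnAxis F Ra (dRR psi Ra 0) (dZZ psi Ra 0))
      (elongationOnAxis (dRR psi Ra 0) (dZZ psi Ra 0)) 0 (nearAxisD psi Ra) := by
  rw [nearAxisD_eq]
  refine not_mercierCriterion_of_le_sqrt (E := elongSq) (s := 1725289220253 / 1000000000000) elongationOnAxis_sq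
    elongationOnAxis_pos elongationOnAxis_bounds.2 (by norm_num) ?_
  rw [q0_sq]
  calc _ ≤ 1 / ((619 / 1000 : ℝ) ^ 2 * q0SqOverFSq) := by unfold elongSq q0SqOverFSq; norm_num
    _ ≤ 1 / (F ^ 2 * q0SqOverFSq) := inv_q0_sq_le hF0 hF

/-- `F_L⁺ = 12363 / 10000`: the model's near-axis LORTZ (sufficient, `δ = 0`) threshold `F_L = 1.23622…` rounded UP. -/
def FlortzAxis : ℝ := 12363 / 10000

/-- **The near-axis Lortz (sufficient, `δ = 0`) criterion HOLDS on the ITER-like analytic equilibrium for every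
`F ≥ 1.2363`** (`Q = 0`, `d = 0`; `q₀ ≥ 2.4618 > 2.46173…`). Its bound `6/(1+E) − 4/E` is RATIONAL
(`lortzBound_of_sq`), so this is pure rational arithmetic. -/
theorem lortzNearAxis_of_le {F : ℝ} (hF : FlortzAxis ≤ F) :
    LortzCriterion (safetyFactorOnAxis F Ra (dRR psi Ra 0) (dZZ psi Ra 0))
      (elongationOnAxis (dRR psi Ra 0) (dZZ psi Ra 0)) 0 (nearAxisD psi Ra) := by
  rw [nearAxisD_eq]
  have hM : (0 : ℝ) < FlortzAxis := by unfold FlortzAxis; norm_num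
  unfold LortzCriterion
  rw [lortzBound_of_sq elongationOnAxis_sq, q0_sq]
  calc 1 / (F ^ 2 * q0SqOverFSq) ≤ 1 / (FlortzAxis ^ 2 * q0SqOverFSq) := inv_q0_sq_le hM hF
    _ < _ := by unfold FlortzAxis elongSq q0SqOverFSq; norm_num

/-- **… and FAILS for every `0 < F ≤ 1.2362`** (Lortz threshold in `F` certified to `(1.2362, 1.2363]`). -/
theorem not_lortzNearAxis_of_le {F : ℝ} (hF0 : 0 < F) (hF : F ≤ 6181 / 5000) :
    ¬ LortzCriterion (safetyFactorOnAxis F Ra (dRR psi Ra 0) (dZZ psi Ra 0))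
      (elongationOnAxis (dRR psi Ra 0) (dZZ psi Ra 0)) 0 (nearAxisD psi Ra) := by
  rw [nearAxisD_eq]
  unfold LortzCriterion
  rw [lortzBound_of_sq elongationOnAxis_sq, q0_sq, not_lt]
  calc _ ≤ 1 / ((6181 / 5000 : ℝ) ^ 2 * q0SqOverFSq) := by unfold elongSq q0SqOverFSq; norm_num
    _ ≤ 1 / (F ^ 2 * q0SqOverFSq) := inv_q0_sq_le hF0 hF

/-- Sanity link (lit-3's `mercierCriterion_of_lortzCriterion`): on the instance the sufficient criterion
implies the necessary one (`κ₀ > 0`, `Q = 0 ≤ 1`). -/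
theorem mercierNearAxis_of_lortz {F : ℝ}
    (h : LortzCriterion (safetyFactorOnAxis F Ra (dRR psi Ra 0) (dZZ psi Ra 0))
      (elongationOnAxis (dRR psi Ra 0) (dZZ psi Ra 0)) 0 (nearAxisD psi Ra)) :
    MercierCriterion (safetyFactorOnAxis F Ra (dRR psi Ra 0) (dZZ psi Ra 0))
      (elongationOnAxis (dRR psi Ra 0) (dZZ psi Ra 0)) 0 (nearAxisD psi Ra) :=
  mercierCriterion_of_lortzCriterion elongationOnAxis_pos (by norm_num) h

end IterLike

/-! ## §3 NSTX-like instance `(ε, κ, δ) = (39/50, 2, 7/20)` -/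

namespace NstxLike

/-- `E = κ₀² = Ψ_RR/Ψ_ZZ` on axis `= 3382585600 / 833319279` (`= −(1+8d₃)/(8d₃)`, exact; `κ₀ ≈ 2.0147`). -/
def elongSq : ℝ := 3382585600 / 833319279

/-- The typed on-axis elongation (Freidberg (6.42) `κ₀ = (Ψ_RR/Ψ_ZZ)^{1/2}`) of the instance is `√E`. -/
theorem elongationOnAxis_eq :
    elongationOnAxis (dRR psi Ra 0) (dZZ psi Ra 0) = Real.sqrt elongSq := by
  obtain ⟨h1, h2⟩ := hessian_axis
  unfold elongationOnAxis elongSq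
  rw [h1, h2]
  norm_num

/-- `κ₀² = E`. -/
theorem elongationOnAxis_sq : elongationOnAxis (dRR psi Ra 0) (dZZ psi Ra 0) ^ 2 = elongSq := by
  rw [elongationOnAxis_eq, Real.sq_sqrt (by unfold elongSq; norm_num)]

/-- `κ₀ > 0`. -/
theorem elongationOnAxis_pos : 0 < elongationOnAxis (dRR psi Ra 0) (dZZ psi Ra 0) := by
  rw [elongationOnAxis_eq]
  exact Real.sqrt_pos.2 (by unfold elongSq; norm_num)

/-- Rational bracket `2014738488919 / 1000000000000 ≤ κ₀ ≤ 50368462223 / 25000000000` (twelve decimals). -/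
theorem elongationOnAxis_bounds :
    (2014738488919 / 1000000000000 : ℝ) ≤ elongationOnAxis (dRR psi Ra 0) (dZZ psi Ra 0) ∧
      elongationOnAxis (dRR psi Ra 0) (dZZ psi Ra 0) ≤ 50368462223 / 25000000000 := by
  rw [elongationOnAxis_eq]
  constructor
  · exact Real.le_sqrt_of_sq_le (by unfold elongSq; norm_num)
  · rw [Real.sqrt_le_left (by norm_num)]
    unfold elongSq; norm_num

/-- `Ψ_RR(R_a, 0) ≠ 0` for the instance. -/
theorem dRR_axis_ne_zero : dRR (psiPCF d₁ d₂ d₃) Ra 0 ≠ 0 := by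
  rw [show psiPCF d₁ d₂ d₃ = psi from rfl, hessian_axis.1]; norm_num

/-- `Ψ_ZZ(R_a, 0) ≠ 0` for the instance. -/
theorem dZZ_axis_ne_zero : dZZ (psiPCF d₁ d₂ d₃) Ra 0 ≠ 0 := by
  rw [show psiPCF d₁ d₂ d₃ = psi from rfl, hessian_axis.2]; norm_num

/-- Near-axis shift `S = −1/2` (NSTX-like instance). -/
theorem nearAxisShift_eq : nearAxisShift psi Ra = -(1 / 2) :=
  nearAxisShift_psiPCF (ε := ε) (by unfold ε; norm_num) shapeFit.1 shapeFit.2.1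
    (by rw [Ra_sq]; unfold ε; norm_num) dRR_axis_ne_zero

/-- Bateman's `d = 0` (NSTX-like instance). -/
theorem nearAxisD_eq : nearAxisD psi Ra = 0 :=
  nearAxisD_psiPCF (ε := ε) (by unfold ε; norm_num) shapeFit.1 shapeFit.2.1
    (by rw [Ra_sq]; unfold ε; norm_num) dRR_axis_ne_zero

/-- The jet-triangularity of the instance equals (7.3.5) at `Q = d = 0` (dictionary self-check). -/
theorem nearAxisTriangularity_eq :
    nearAxisTriangularity psi Ra (elongationOnAxis (dRR psi Ra 0) (dZZ psi Ra 0))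
      = triangularity (elongationOnAxis (dRR psi Ra 0) (dZZ psi Ra 0)) 0 0 :=
  nearAxisTriangularity_psiPCF (ε := ε) (by unfold ε; norm_num) shapeFit.1 shapeFit.2.1
    (by rw [Ra_sq]; unfold ε; norm_num) dRR_axis_ne_zero dZZ_axis_ne_zero elongationOnAxis_pos.ne'

/-- `1/q₀(F)² = 1/(F²·r)` is antitone in `F > 0`: the two one-sided comparisons used below. -/
theorem inv_q0_sq_le {F G : ℝ} (hG : 0 < G) (hGF : G ≤ F) :
    1 / (F ^ 2 * q0SqOverFSq) ≤ 1 / (G ^ 2 * q0SqOverFSq) := by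
  have hr : (0 : ℝ) < q0SqOverFSq := by unfold q0SqOverFSq; norm_num
  apply one_div_le_one_div_of_le (by positivity)
  exact mul_le_mul_of_nonneg_right (pow_le_pow_left₀ hG.le hGF 2) hr.le

/-- `F_M⁺ = 5593 / 5000`: the model's near-axis Mercier threshold `F_M = 1.11855…` rounded UP (4 decimals). -/
def FmercierAxis : ℝ := 5593 / 5000

/-- **The near-axis Mercier (necessary, `δ = 1`) criterion HOLDS on the NSTX-like analytic equilibrium for
every `F ≥ 1.1186`** (`Q = 0`, `d = 0`; i.e. `q₀(F) ≥ 1.3770 > q₀* = 1.37697…`). CERTIFIED by lit-3's rational test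
`mercierCriterion_of_sqrt_le` with `s = 2014738488919 / 1000000000000 ≤ κ₀`. -/
theorem mercierNearAxis_of_le {F : ℝ} (hF : FmercierAxis ≤ F) :
    MercierCriterion (safetyFactorOnAxis F Ra (dRR psi Ra 0) (dZZ psi Ra 0))
      (elongationOnAxis (dRR psi Ra 0) (dZZ psi Ra 0)) 0 (nearAxisD psi Ra) := by
  rw [nearAxisD_eq]
  have hM : (0 : ℝ) < FmercierAxis := by unfold FmercierAxis; norm_num
  refine mercierCriterion_of_sqrt_le (E := elongSq) (s := 2014738488919 / 1000000000000) elongationOnAxis_sq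
    (by norm_num) elongationOnAxis_bounds.1 (by norm_num) ?_
  rw [q0_sq]
  calc 1 / (F ^ 2 * q0SqOverFSq) ≤ 1 / (FmercierAxis ^ 2 * q0SqOverFSq) := inv_q0_sq_le hM hF
    _ < _ := by unfold FmercierAxis elongSq q0SqOverFSq; norm_num

/-- **… and FAILS for every `0 < F ≤ 1.1185`** — so the MODEL's near-axis Mercier threshold in `F` is
certified to lie in `(1.1185, 1.1186]` (in `q₀`: `q₀* ∈ (1.3769, 1.3770]`). CERTIFIED by
`not_mercierCriterion_of_le_sqrt` with `s = 50368462223 / 25000000000 ≥ κ₀`. -/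
theorem not_mercierNearAxis_of_le {F : ℝ} (hF0 : 0 < F) (hF : F ≤ 2237 / 2000) :
    ¬ MercierCriterion (safetyFactorOnAxis F Ra (dRR psi Ra 0) (dZZ psi Ra 0))
      (elongationOnAxis (dRR psi Ra 0) (dZZ psi Ra 0)) 0 (nearAxisD psi Ra) := by
  rw [nearAxisD_eq]
  refine not_mercierCriterion_of_le_sqrt (E := elongSq) (s := 50368462223 / 25000000000) elongationOnAxis_sq
    elongationOnAxis_pos elongationOnAxis_bounds.2 (by norm_num) ?_
  rw [q0_sq]
  calc _ ≤ 1 / ((2237 / 2000 : ℝ) ^ 2 * q0SqOverFSq) := by unfold elongSq q0SqOverFSq; norm_num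
    _ ≤ 1 / (F ^ 2 * q0SqOverFSq) := inv_q0_sq_le hF0 hF

/-- `F_L⁺ = 907 / 500`: the model's near-axis LORTZ (sufficient, `δ = 0`) threshold `F_L = 1.81395…` rounded UP. -/
def FlortzAxis : ℝ := 907 / 500

/-- **The near-axis Lortz (sufficient, `δ = 0`) criterion HOLDS on the NSTX-like analytic equilibrium for every
`F ≥ 1.814`** (`Q = 0`, `d = 0`; `q₀ ≥ 2.2330 > 2.23304…`). Its bound `6/(1+E) − 4/E` is RATIONAL
(`lortzBound_of_sq`), so this is pure rational arithmetic. -/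
theorem lortzNearAxis_of_le {F : ℝ} (hF : FlortzAxis ≤ F) :
    LortzCriterion (safetyFactorOnAxis F Ra (dRR psi Ra 0) (dZZ psi Ra 0))
      (elongationOnAxis (dRR psi Ra 0) (dZZ psi Ra 0)) 0 (nearAxisD psi Ra) := by
  rw [nearAxisD_eq]
  have hM : (0 : ℝ) < FlortzAxis := by unfold FlortzAxis; norm_num
  unfold LortzCriterion
  rw [lortzBound_of_sq elongationOnAxis_sq, q0_sq]
  calc 1 / (F ^ 2 * q0SqOverFSq) ≤ 1 / (FlortzAxis ^ 2 * q0SqOverFSq) := inv_q0_sq_le hM hF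
    _ < _ := by unfold FlortzAxis elongSq q0SqOverFSq; norm_num

/-- **… and FAILS for every `0 < F ≤ 1.8139`** (Lortz threshold in `F` certified to `(1.8139, 1.814]`). -/
theorem not_lortzNearAxis_of_le {F : ℝ} (hF0 : 0 < F) (hF : F ≤ 18139 / 10000) :
    ¬ LortzCriterion (safetyFactorOnAxis F Ra (dRR psi Ra 0) (dZZ psi Ra 0))
      (elongationOnAxis (dRR psi Ra 0) (dZZ psi Ra 0)) 0 (nearAxisD psi Ra) := by
  rw [nearAxisD_eq]
  unfold LortzCriterion
  rw [lortzBound_of_sq elongationOnAxis_sq, q0_sq, not_lt]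
  calc _ ≤ 1 / ((18139 / 10000 : ℝ) ^ 2 * q0SqOverFSq) := by unfold elongSq q0SqOverFSq; norm_num
    _ ≤ 1 / (F ^ 2 * q0SqOverFSq) := inv_q0_sq_le hF0 hF

/-- Sanity link (lit-3's `mercierCriterion_of_lortzCriterion`): on the instance the sufficient criterion
implies the necessary one (`κ₀ > 0`, `Q = 0 ≤ 1`). -/
theorem mercierNearAxis_of_lortz {F : ℝ}
    (h : LortzCriterion (safetyFactorOnAxis F Ra (dRR psi Ra 0) (dZZ psi Ra 0))
      (elongationOnAxis (dRR psi Ra 0) (dZZ psi Ra 0)) 0 (nearAxisD psi Ra)) :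
    MercierCriterion (safetyFactorOnAxis F Ra (dRR psi Ra 0) (dZZ psi Ra 0))
      (elongationOnAxis (dRR psi Ra 0) (dZZ psi Ra 0)) 0 (nearAxisD psi Ra) :=
  mercierCriterion_of_lortzCriterion elongationOnAxis_pos (by norm_num) h

end NstxLike

end Summit.Ventures.FusionMHD.Models.SolovevPCF
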